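import Summits.ABC.IUTFork.Cor312OrbitCoveringWitness
import Summits.ABC.IUTFork.Repair.CandJoshi3
import Summits.ABC.IUTFork.Repair.CandJoshi1
import HarnessLib

/-!
# IUT REPAIR branch, sub-cell B3 (Joshi) — candidate 34: the theta-values LOCUS in COVERING FORM, evaluated at the honest bed COV

Proof-only evaluation file (D-0012; no definition, no `Prop` fact, nothing asserted about print) of the abc-iut cell's IUT REPAIR branch B
(human ruling D-0077(2); REPAIR-SPEC §3 T-a…T-d; rung LADDER-ABC:A2.RP ⊆ A2.B), seat abc-iut-rp-j3 gen 3, row proposal RP-J13 (← J34, an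
EXISTING-DECL row: H = abc-iut-rp-j1's H_J3 `Repair.CandJoshi3.LocusCovers`, p428372 — Joshi, arXiv:2111.04890v2 §9 p. 15 «Θ̃ := the
smallest Aut-stable subset containing all lifts», Thm. 9.1.1 p. 13; T-d of record for that typing: rp-lit-2 sheet
plan/repair/lit/TD-LANE4-RP-J01-J02-rp-lit-2.md, STRONGER-in-form declared). TAKES NO SIDE on [IUTchIII] Cor. 3.12 or on any author
(Mochizuki / Scholze–Stix / Joshi / Dupuy–Hilado); candidates are hypotheses; typed ≠ proved; instantiated ≠ endorsed.

THE OPEN CELL (rp-j1 gen 3, plan/repair/j1/J1-CENSUS.md §E «Open for a successor»): a bed realising H_J3 WITH Step (x) + exact `j²` + the pins,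
separating the UNION level H_J3 from the SINGLE-TRANSLATE level H_J1 (`CandJoshi1.JoshiDominance`), which coincide on every bed of record
(`CandJoshi3Profile`). THE BED: COV = `Cor312OrbitCovering{Shells,Lattices,Volumes,Model,Witness}` (this seat): rank-2 carrier `log(𝒟⊢_v) := ℚ²`
over c312-7's one-place index, "Ism" = the lattice automorphisms `GL₂(ℤ)` (Dupuy–Hilado's reading of (Ind2)), Θ-pilot region an ANISOTROPIC
lattice of AVERAGE depth exactly `j²` inside the q-pilot region `p·𝓘`; by Bezout on the first tensor factor the UNION of the ⟨(Ind1)∪(Ind2)⟩-images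
of the Θ-lattice IS `p·𝓘` (`CoveringWitness.sUnion_possibleImages`).

THE CELLS (kernel, by name from the bed):
* (T-c) **H_J3 `LocusCovers` HOLDS at COV** (`locusCovers_cov`) with the FULL HONESTY VECTOR of the ∀-countermodel p419757 (`cov_honesty_vector`:
  pins, KummerB, MultiradialCompat, BridgeHyps, Step (x) hAdm/hvol non-trivially, EXACT `j²`-scaling, label-INDEPENDENT q-volume, `|log q| > 0`),
  the typed Thm. 3.11 (i)–(iii), the printed Statement (equality) and the (xi-f) Licence TRUE and `S` FALSE — grade **SAT+, locus «orbit-UNION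
  covering (anisotropic Θ-image)»** (`locusCovers_satPlus_covering`, the §2 (4) shape + the honesty clauses + `¬S` + `¬H_J1`);
* **H_J1 `JoshiDominance` FAILS at COV** (`not_joshiDominance_cov`): no single translate of any column's Θ-region contains the q-region — the
  FIRST SEPARATION of the union level from the single-translate level (`union_level_separated`);
* **H_J2 `JoshiVolumeDominance` FAILS at COV** (`not_joshiVolumeDominance_cov`): every possible image has volume `−4 < −1` at `j = 2` — Joshi's
  packetwise VOLUME dominance (ATS III Thm. 7.3.1) is false here although the LOCUS covers and the Statement holds: on COV the Corollary's
  inequality comes from the UNION, not from any one «arithmetic holomorphic structure»;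
* **H_J3′ `ShellFilling` FAILS at COV** (`not_shellFilling_cov`): the hull-set `p·𝓘 ⊇ thetaLat` inside the log-shell is NOT a possible image.
READING for §J (neutral): typed over the frozen interface, Joshi's theta-values locus in its COVERING form (H_J3) is the one J-reading that an
HONEST bed satisfies together with the printed Statement — through an infinite lattice-automorphism indeterminacy acting on an ANISOTROPIC
Θ-image, never through a single translate (H_J1 ✗) or single-image volume (H_J2 ✗); `S` stays false (p419757). Whether [IUTchI] Def. 3.1
data supply such anisotropy, and whether print's (Ind2) is the lattice-automorphism group, is not modelled — no side taken. Standard axioms only.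
[claim: Joshi2021ATSII, status: disputed] [claim: Joshi2024ATSIII, status: disputed] [claim: Mochizuki2012, status: disputed]
[cite: ScholzeStix2018, §2.2 pp. 9–10] [cite: DupuyHilado2020, §6.2]
-/

noncomputable section

open Set

namespace Summit.ABC.IUTFork.Repair.CandJoshi34

open Thm311 Cor312 Cor312.Checks Cor312Vol Cor312Vol.CoveringWitness Literature.IUT.LogThetaLattice

variable (p : ℕ) [hp : Fact p.Prime]

/-! ## 1. The J-cells at COV -/

/-- **(T-c) H_J3 `LocusCovers` HOLDS at COV**: at every label the q-pilot's `rho`-region is covered by (indeed equals) the union of the possible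
images of the Θ-pilot. [folklore] -/
theorem locusCovers_cov : CandJoshi3.LocusCovers (covFull p).toLatticeSituation (covSetting p) (rho p) (covQK p) :=
  fun j vQ => cov_rho_qK_subset_sUnion p j vQ

/-- **H_J1 `JoshiDominance` FAILS at COV** (at `j = 2`: no single ⟨(Ind1)∪(Ind2)⟩-translate of any column's Θ-region contains the q-region).
[folklore] -/
theorem not_joshiDominance_cov : ¬ CandJoshi1.JoshiDominance (covFull p).toLatticeSituation (covSetting p) (rho p) (covQK p) := by
  intro h
  obtain ⟨Φ, hΦ, m, hm⟩ := h (Setting.labelSucc ⟨1, by decide⟩) ()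
  exact cov_not_subset_single_image p () hΦ m hm

/-- **THE UNION LEVEL IS SEPARATED FROM THE SINGLE-TRANSLATE LEVEL**: H_J3 ∧ ¬H_J1 at COV (on every bed of record they coincide,
`CandJoshi3Profile`). [folklore] -/
theorem union_level_separated :
    CandJoshi3.LocusCovers (covFull p).toLatticeSituation (covSetting p) (rho p) (covQK p) ∧
      ¬ CandJoshi1.JoshiDominance (covFull p).toLatticeSituation (covSetting p) (rho p) (covQK p) :=
  ⟨locusCovers_cov p, not_joshiDominance_cov p⟩

/-- **H_J2 `JoshiVolumeDominance` FAILS at COV** (at `j = 2` every possible image has volume `−4`, below the q-volume `−1`). [folklore] -/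
theorem not_joshiVolumeDominance_cov : ¬ CandJoshi1.JoshiVolumeDominance (covSetting p) := by
  intro h
  obtain ⟨U, hU, hle⟩ := h ⟨1, by decide⟩ ()
  rw [covSetting_qLocal] at hle
  have hv : ((covSituation p).D (covSetting p).n).logvol (Setting.labelSucc ⟨1, by decide⟩) () U = -(((Setting.labelSucc (T := toyIndex) ⟨1, by decide⟩ : ℕ) : ℝ) ^ 2) :=
    covVol_of_mem_possibleImages p hU
  rw [hv] at hle
  norm_num [Setting.labelSucc] at hle

/-- **H_J3′ `ShellFilling` FAILS at COV**: the hull-set `p·𝓘` contains the Θ-lattice and lies in the log-shell `𝓘` but is no possible image at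
`j = 2` (possible images have volume `−4`, `p·𝓘` has `−1`). [folklore] -/
theorem not_shellFilling_cov : ¬ CandJoshi3.ShellFilling (covFull p).toLatticeSituation (covSetting p) (rho p) := by
  intro h
  have hj : (Setting.labelSucc (T := toyIndex) ⟨1, by decide⟩) ≠ 0 := Setting.labelSucc_ne_zero _
  have h1 := h (Setting.labelSucc ⟨1, by decide⟩) () (qBall p _ ()) (qBall_mem_hul p _ ())
    ⟨0, by
      rw [show ((covFull p).toLatticeSituation.col (covSetting p).n).frobΨ 0 = covPsi p from rfl, rho_covPsi]
      exact thetaLat_subset_qBall p _ ()⟩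
    ((ball_subset_ball_iff p () _ 0).2 (Nat.zero_le _))
  have hv := covVol_of_mem_possibleImages p h1
  rw [covVol_qBall] at hv
  unfold qDepth at hv
  rw [if_neg hj] at hv
  norm_num [Setting.labelSucc] at hv

/-! ## 2. (T-c) of record for RP-J02a: SAT+ by orbit covering, with the honesty vector, `¬S` and `¬H_J1` -/

/-- **(T-c) `locusCovers_satPlus_covering`** — REPAIR-SPEC §2 (4) shape PLUS the honesty clauses of the ∀-countermodel, the printed Statement,
the (xi-f) Licence, `¬S` and `¬H_J1`: H_J3 is jointly satisfiable with typed Thm. 3.11 ∧ BridgeHyps ∧ `|log(q)| > 0` ∧ PinnedRegions3 at a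
bed with Step (x) log-volume invariance, EXACT `j²`-scaling and label-independent q-volume where the Statement and the Licence HOLD while `S`
and Joshi's single-translate dominance FAIL. Grade SAT+ (all interface clauses + both reading clauses), locus «orbit-UNION covering
(anisotropic Θ-image)». Witness: COV at `p = 2`. [folklore] -/
theorem locusCovers_satPlus_covering :
    ∃ (T : ThetaIndex) (F : FullSituation T) (P : Cor312.Setting F.toLatticeSituation.toSituation)
      (ρ : (∀ v : T.V, v ∈ T.Vbad → Set (F.L.StarPacket v)) → ∀ (j : T.Label) (vQ : T.VQ), Set (F.L.Packet j vQ))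
      (qK : ∀ v : T.V, v ∈ T.Vbad → Set (F.L.StarPacket v)),
      F.Statement ∧ BridgeHyps P ∧ P.AbsLogQPos ∧ PinnedRegions3 F.toLatticeSituation P ρ qK ∧
        CandJoshi3.LocusCovers F.toLatticeSituation P ρ qK ∧
        (F.D P.n).LogvolInvariant ∧
        (∀ (i : Fin T.lstar) (vQ : T.VQ),
          (F.D P.n).logvol _ vQ (P.thetaRegion3 (Setting.labelSucc i) vQ) = (((i : ℕ) + 1 : ℕ) : ℝ) ^ 2 * P.qLocal (Setting.labelSucc i) vQ) ∧
        (∀ (i i' : Fin T.lstar) (vQ : T.VQ), P.qLocal (Setting.labelSucc i) vQ = P.qLocal (Setting.labelSucc i') vQ) ∧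
        P.Statement ∧ Thm311ToCor312.Licence P ∧
        ¬ PilotKummerIndRelated F.toLatticeSituation P ρ qK ∧ ¬ CandJoshi1.JoshiDominance F.toLatticeSituation P ρ qK :=
  ⟨toyIndex, covFull 2, covSetting 2, rho 2, covQK 2, covFull_statement 2, covSetting_bridgeHyps 2, covSetting_absLogQPos 2,
    cov_pinnedRegions3 2, locusCovers_cov 2, covData_logvolInvariant 2, (cov_honesty_vector 2).2.2.2.2.2.2.1,
    (cov_honesty_vector 2).2.2.2.2.2.2.2, covSetting_statement 2, cov_licence 2, covSetting_not_pilotKummerIndRelated 2,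
    not_joshiDominance_cov 2⟩

/-- **The J-PROFILE at COV** in one line: H_J3 ✓ · H_J1 ✗ · H_J2 ✗ · H_J3′ ✗ · Statement ✓ · Licence ✓ · S ✗. [folklore] -/
theorem cov_J_profile :
    CandJoshi3.LocusCovers (covFull p).toLatticeSituation (covSetting p) (rho p) (covQK p) ∧
      ¬ CandJoshi1.JoshiDominance (covFull p).toLatticeSituation (covSetting p) (rho p) (covQK p) ∧
      ¬ CandJoshi1.JoshiVolumeDominance (covSetting p) ∧
      ¬ CandJoshi3.ShellFilling (covFull p).toLatticeSituation (covSetting p) (rho p) ∧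
      (covSetting p).Statement ∧ Thm311ToCor312.Licence (covSetting p) ∧
      ¬ PilotKummerIndRelated (covFull p).toLatticeSituation (covSetting p) (rho p) (covQK p) :=
  ⟨locusCovers_cov p, not_joshiDominance_cov p, not_joshiVolumeDominance_cov p, not_shellFilling_cov p, covSetting_statement p,
    cov_licence p, covSetting_not_pilotKummerIndRelated p⟩

end Summit.ABC.IUTFork.Repair.CandJoshi34

end
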